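import Summits.BirchSwinnertonDyer.BirchSwinnertonDyer.Theorems.AdditiveBranchIMCGordTwoRankOneCM
import Summits.BirchSwinnertonDyer.Rank1Residual.Additive.GordBranchCertificateCurrencies
import HarnessLib

/-!
# Route `AdditiveBranchIMC` (rung K1), crux `GordTwoRankOne` (item 19358): on the UNIT SLICE
# `‖A′‖_p = 1` the rank-one LOWER half needs NO Λ-adic input and NO Kato/Wuthrich reading — the crux holds
# there from published facts + ONE certificate, at EVERY (G-ord, `e = 2`) pair, any residual image, CM or not
# (cell `bsd-addord`, seat `bsd-addord-k1-c3` gen 4, D-0074 row B2; `--supports stmt-BirchSwinnertonDyer-19358 --as helper`)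

HONEST FRAMING. THEOREMS ONLY: no definition, no named fact minted, no `sorry`, nothing booked; BSD is not
proved by any of this; crux `GordTwoRankOne` (∀ `E/ℚ` of analytic rank `1`, ∀ odd additive (G)-ordinary `p` of
semistability index `2`: `ord_p #Ш(E)_an ≤ ord_p #Ш(E)`) stays OPEN at class level, on exactly the CONTENT rows
displayed in §5 (`¬ BranchUnitCoeffAt W p 1`: `v_p(A′) ≥ 1` or `A′ = 0`), where it needs the split children
`GordTwoLambdaEven` / `GordTwoLambdaOdd` (Λ-adic, NOT in print) and `GordTwoRankOneClassCert` (Schneider-type).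

THE OBSERVATION (gen 4). In the seat's rank-one chain (gen 0, `…GordTwoRankOneOffCaseOne` §2; its odd / `p = 3`
twins) the lower half is reached as
`identity (kernel p-adic Gross–Zagier: A′·log_p γ = u·q·Reg_p(E,Dh), L′(E,1) = q·Ω_E·Reg_∞) + Schneider for Dh
+ CycLowerBoundAt W p Dh + Delbourgo 2002 (A)/(B♮) + Mazur Cor. 5.15 ⟹ MissingLowerBoundAt W p`, and the typed
input `CycLowerBoundAt W p Dh` — "for every generator `fE` of `char_Λ X(E/ℚ_∞)`, `[T¹]fE·log_p γ = c·q·Reg_p`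
with `c ∈ ℤ_p`" — was supplied from the Λ-adic branch LOWER containment `ChiBranchLowerDivisibility[Odd]At W p`
(NOT in print). On the unit slice that containment is idle: if the Néron-normalised first branch coefficient
`A′ = ϖ·[T¹]L_p(f_V, α_V, ω^{(p−1)/2})` is a `p`-ADIC UNIT, then
**`c := [T¹]fE · u · A′⁻¹ ∈ ℤ_p`** does it (`[T¹]fE ∈ ℤ_p` because `fE ∈ Λ = ℤ_p⟦T⟧`), and Schneider for `Dh` is
the identity read with `A′ ≠ 0`. So:

* §1 `cycLowerBoundAt_of_identity_of_norm_eq_one` (pure algebra) and the class-agnostic core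
  `missingLowerBoundAt_rankOne_of_identity_of_norm_eq_one`.
* §2–§4 cell (G-ord, `e = 2`), non-CM, `r_an = 1`, ANY residual image, anomalous or not, at `p ≡ 1 (mod 4)`,
  `p ≡ 3 (mod 4)` (`p ≥ 7`), `p = 3`: `MissingLowerBoundAt W p` from the PUBLISHED binders of gen 0 (`hMaz`,
  `hCyc`/`hCyc3`, `hArt`, `h73`, `hWald`, `hDel`/`hDel3`, `hmod`, `hmodD`, `hmodN`, `hGZK`) + the ONE per-pair
  certificate `BranchUnitCoeffAt W p 1` (`‖A′‖_p = 1`, the C-UNIT certificate of the seat's gen-3 memo — the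
  number the cell's A′ engines output, asked to have valuation `0`). NO `hK` (Kato 17.4 (3) half reading), NO
  `hW16` (Wuthrich Thm. 16 half reading), NO surjectivity / reducibility / Case-1 case split, NO budget.
* §5 the UNIT SLICE OF THE CRUX, all odd `p`, CM rows included (Li–Liu–Tian, `hLLT`):
  `gordTwoRankOne_unitSlice_of_facts_of_liLiuTian : … → ∀ W p, r_an = 1 → N10.CellGordTwo W p →
  BranchUnitCoeffAt W p 1 → MissingLowerBoundAt W p`. The sequel `…UnitSliceCrux.lean` reads the crux BY NAME
  reduced to its CONTENT rows (`¬ BranchUnitCoeffAt W p 1`), resp. the split children asked only there.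

Compared with gen 3 (`…UnitCoeff.lean` / `…UnitCoeffRed.lean`: BOTH halves of `BSD(E,p)` on X4♯ ∩ surj via
`hK`, on X3♯ via `hW16`, from the same certificate + the free rank-one budget): for the LOWER half — the
crux's own currency and the K1 leaf's — the reading binders and the image split disappear, and the rows
X4 ∧ ¬surj (O8 ∩ (G-ord, `e = 2`), no door so far) are covered too. The UPPER half is untouched (it is the
`μ = 0` question; Kato's / Wuthrich's integral halves remain its only source in the tree).

NOT claimed: anything on content rows (`v_p(A′) ≥ 1`: there the Λ-adic children carry content; `A′ = 0`:
Schneider fails for the datum); the upper half; (M) (crux `MultLower`), defect `3,4,6` (crux `GordHigherLower`);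
any booking. The certificate is per pair (ENGINE value, two-engine rule), never a class statement.

References: [Delbourgo2002] Thm. (A), (B) (p. 40), p. 67 (iv), p. 69; [Delbourgo1998] §2.5 BS-D(p) (pp. 151–152);
[Disegni2017] Thm. A, B; [Mazur1972Towers] Cor. 5.15; [GrossZagier1986] I.(7.3); [Pal2012] Thm. 3.2;
[MazurTateTeitelbaum1986Invent] §I.13–14; [LiLiuTian2024] Thm. 1.1 (i); [Miller2011LMS] Def. 1.1;
[SteinWuthrich2013] §4 (shape of unit-coefficient certificates); cell TARGET.md E39/E68/E74, HOME/k1-c3/CERT-ROADS-19358-g3.md.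
-/

set_option autoImplicit false
set_option linter.dupNamespace false

noncomputable section

open scoped Classical MatrixGroups ModularForm NumberField

open CongruenceSubgroup WeierstrassCurve NumberField IsDedekindDomain Field
  Literature.NumberTheory.EllipticCurves Literature.NumberTheory.EllipticCurves.ModularForms
  Literature.NumberTheory.EllipticCurves.GreenbergVatsal2000
  Literature.NumberTheory.EllipticCurves.Rank1Residual
  Literature.NumberTheory.EllipticCurves.Rank1Residual.Typed
  Literature.NumberTheory.EllipticCurves.Delbourgo2002
  Literature.NumberTheory.EllipticCurves.Disegni2017
  Literature.NumberTheory.GaloisRepresentations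
  Summit.BirchSwinnertonDyer.Rank1Residual.AdditivePotMult
  Summit.BirchSwinnertonDyer.Rank1Residual.Additive

namespace Summit.BirchSwinnertonDyer.BirchSwinnertonDyer.Theorems.AdditiveBranchIMCGordTwoRankOne

variable {W : WeierstrassCurve ℚ} [W.IsElliptic] [W.IsGloballyMinimal] {p : ℕ} [hp : Fact p.Prime]

/-! ### §1 The algebra: `CycLowerBoundAt` is FREE on the unit slice, given the identity -/

omit [W.IsGloballyMinimal] in
/-- **`CycLowerBoundAt W p Dh` from ONE identity with a UNIT analytic coefficient.** If `rank E(ℚ) = 1`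
(GZK with `r_an = 1`), `L′(E,1) = q·Ω_E·Reg_∞(E)`, and `a·log_p γ = u·q·Reg_p(E,Dh)` for some `a ∈ ℚ_p` with
`‖a‖_p = 1` (intended: `a = A′ = ϖ·[T¹]L_p(f_V, α_V, ω^{(p−1)/2})`) and `u ∈ ℤ_p^×`, then for every cyclotomic
dual datum `D` and every generator `fE` of `char_Λ X(E/ℚ_∞)`: `[T¹]fE·log_p γ = c·q·Reg_p(E,Dh)` with
`c := [T¹]fE·u·a⁻¹ ∈ ℤ_p`. No Λ-adic containment, no Euler system: `[T¹]fE ∈ ℤ_p` is all that is used.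
[cite: Delbourgo1998, §2.5 BS-D(p) (ii) (pp. 151–152) (shape only)] [cite: Washington1997, §7.1] -/
theorem cycLowerBoundAt_of_identity_of_norm_eq_one
    (hGZK : rank_eq_analyticRank_of_analyticRank_le_one) (hr : W.analyticRank = 1)
    {Dh : PAdicHeightData W p} {u : ℤ_[p]ˣ} {q : ℚ} {a : ℚ_[p]}
    (hlead : W.leadingLCoeff = (q : ℂ) * (W.realPeriodRat : ℂ) * (W.regulator : ℂ))
    (hid : a * padicLog p (cyclotomicGenerator p) = ((u : ℤ_[p]) : ℚ_[p]) * (q : ℚ_[p]) * padicRegulator Dh)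
    (ha : ‖a‖ = 1) : CycLowerBoundAt W p Dh := by
  intro κ γ hκ hγ hγ' D fE hchar
  have hmw : W.mordellWeilRank = 1 := by rw [(hGZK W (by rw [hr])).1, hr]
  have ha0 : a ≠ 0 := fun h ↦ by rw [h, norm_zero] at ha; exact zero_ne_one ha
  have hu : ‖((u : ℤ_[p]) : ℚ_[p])‖ = 1 := by
    rw [← PadicInt.norm_def]
    exact PadicInt.isUnit_iff.mp u.isUnit
  -- the cofactor `c := [T¹]fE · u · a⁻¹` is a `p`-adic integer
  have hc : ‖((PowerSeries.coeff 1 fE : ℤ_[p]) : ℚ_[p]) * ((u : ℤ_[p]) : ℚ_[p]) * a⁻¹‖ ≤ 1 := by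
    rw [norm_mul, norm_mul, norm_inv, ha, hu, inv_one, mul_one, mul_one, ← PadicInt.norm_def]
    exact PadicInt.norm_le_one _
  refine ⟨q, ⟨_, hc⟩, hlead, ?_⟩
  rw [hmw, pow_one]
  show ((PowerSeries.coeff 1 fE : ℤ_[p]) : ℚ_[p]) * padicLog p (cyclotomicGenerator p) =
    ((PowerSeries.coeff 1 fE : ℤ_[p]) : ℚ_[p]) * ((u : ℤ_[p]) : ℚ_[p]) * a⁻¹ * (q : ℚ_[p]) *
      padicRegulator Dh
  calc ((PowerSeries.coeff 1 fE : ℤ_[p]) : ℚ_[p]) * padicLog p (cyclotomicGenerator p)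
      = ((PowerSeries.coeff 1 fE : ℤ_[p]) : ℚ_[p]) * a⁻¹ * (a * padicLog p (cyclotomicGenerator p)) := by
        field_simp
    _ = ((PowerSeries.coeff 1 fE : ℤ_[p]) : ℚ_[p]) * a⁻¹ *
          (((u : ℤ_[p]) : ℚ_[p]) * (q : ℚ_[p]) * padicRegulator Dh) := by rw [hid]
    _ = ((PowerSeries.coeff 1 fE : ℤ_[p]) : ℚ_[p]) * ((u : ℤ_[p]) : ℚ_[p]) * a⁻¹ * (q : ℚ_[p]) *
          padicRegulator Dh := by ring

omit [W.IsGloballyMinimal] in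
/-- **CORE (class-agnostic, rank one): the lower half from ONE identity with a unit coefficient.** `W` globally
minimal, `p` odd, `r_an = 1` (GZK), a height datum `Dh` with Delbourgo's (B♮) clauses
(`LeadingTermClausesIntrinsic`), `X(E/ℚ_∞)` torsion for every cyclotomic datum (`hA`, Delbourgo 2002 (A)), a
place `v ∣ p` with `c_v(E) ≠ 0` and `p ∤ [E(ℚ_p) : N_∞ E(ℚ_p)]` whenever finite (`hι`, Mazur 1972 Cor. 5.15 via the
twist transport), and the identity `a·log_p γ = u·q·Reg_p(E,Dh)`, `L′(E,1) = q·Ω_E·Reg_∞`, with `‖a‖_p = 1`: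
then `ord_p #Ш(E)_an ≤ ord_p #Ш(E)`. Schneider for `Dh` is the identity with `a ≠ 0`
(`padicRegulator_ne_zero_of_twisted_identity`); the lower factorisation is §1; the rest is
`missingLowerBoundAt_of_cycLowerBound_of_not_dvd_index`. [cite: Delbourgo2002, Theorem (A), (B) (p. 40), p. 67 (iv), p. 69]
[cite: Mazur1972Towers, Cor. 5.15 with Remark (p. 229)] [cite: Miller2011LMS, Def. 1.1] -/
theorem missingLowerBoundAt_rankOne_of_identity_of_norm_eq_one
    (hGZK : rank_eq_analyticRank_of_analyticRank_le_one) (hr : W.analyticRank = 1) (hp2 : p ≠ 2)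
    {Dh : PAdicHeightData W p} (hBι : LeadingTermClausesIntrinsic W p Dh)
    (hA : ∀ (κ : ZpExtension ℚ p) (γ : Field.absoluteGaloisGroup ℚ),
      κ.IsCyclotomic → κ.IsTopGenerator γ → ∀ D : W.SelmerDualData κ γ, D.IsTorsion)
    (v : HeightOneSpectrum (𝓞 ℚ)) (hv : (p : 𝓞 ℚ) ∈ v.asIdeal) (hcp : W.tamagawaNumberAt v ≠ 0)
    (hι : ∀ κ : ZpExtension ℚ p, κ.IsCyclotomic →
      localUniversalNormIndex (W := W) (v.adicCompletion ℚ) κ ⊤ ≠ 0 →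
      ¬ p ∣ localUniversalNormIndex (W := W) (v.adicCompletion ℚ) κ ⊤)
    {u : ℤ_[p]ˣ} {q : ℚ} {a : ℚ_[p]}
    (hlead : W.leadingLCoeff = (q : ℂ) * (W.realPeriodRat : ℂ) * (W.regulator : ℂ))
    (hid : a * padicLog p (cyclotomicGenerator p) = ((u : ℤ_[p]) : ℚ_[p]) * (q : ℚ_[p]) * padicRegulator Dh)
    (ha : ‖a‖ = 1) : MissingLowerBoundAt W p := by
  have ha0 : a ≠ 0 := fun h ↦ by rw [h, norm_zero] at ha; exact zero_ne_one ha
  have hSch : SchneiderConjecture Dh := by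
    rw [SchneiderConjecture]
    exact padicRegulator_ne_zero_of_twisted_identity hp2 ha0 hid
  exact missingLowerBoundAt_of_cycLowerBound_of_not_dvd_index W p hBι hSch hA hGZK (by rw [hr]) v hv hcp hι
    (cycLowerBoundAt_of_identity_of_norm_eq_one hGZK hr hlead hid ha)

/-! ### §2 Cell (G-ord, `e = 2`), `p ≡ 1 (mod 4)`: the lower half from published facts + the C-UNIT certificate -/

/-- **Cell (G-ord, `e = 2`) (`N10.CellGordTwo`), `p ≡ 1 (mod 4)`, `E` non-CM, `r_an(E) = 1`, ANY residual image
(reducible or not, surjective or not, Case-1 member or not), ANOMALOUS OR NOT: the LOWER half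
`ord_p #Ш(E)_an ≤ ord_p #Ш(E)` from PUBLISHED named facts + the ONE per-pair certificate `BranchUnitCoeffAt W p 1`
(`‖ϖ·[T¹]L_p(f_V, α_V, ω^{(p−1)/2})‖_p = 1` at every good-ordinary twist model).** Published binders exactly as in
gen 0's `cellGordTwo_missingLowerBoundAt_rankOne_of_facts_of_chiBranchLower_of_branchCoeffOneNeZero` (`hMaz`,
`hCyc`, `hArt`, `h73`, `hWald`, `hDel`, modularity, GZK); its two typed inputs (Λ-adic lower containment, `A′ ≠ 0`)
are REPLACED by the unit certificate, the Λ-adic one being idle on the unit slice (§1). No Kato / Wuthrich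
reading, no image hypothesis. Chain: twist model, gen 0's `exists_datum_identity_of_facts`, the core.
[cite: Delbourgo2002, Theorem (A), (B) (p. 40), p. 67 (iv), p. 69] [cite: Mazur1972Towers, Cor. 5.15]
[cite: Disegni2017, Theorem A/B (arXiv v3 PDF 7–9)] [cite: Pal2012, Thm. 3.2] [cite: Miller2011LMS, Def. 1.1]
[cite: SteinWuthrich2013, §4 (shape of the certificate)] -/
theorem cellGordTwo_missingLowerBoundAt_rankOne_of_facts_of_unitCoeffOne
    (hMaz : Mazur1972.cor515_universalNormIndex) (hCyc : delbourgoDatum_cycLineGrossZagier)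
    (hArt : rankinSelbergEulerProductHecke_baseChangeDirichlet_eq) (h73 : GrossZagier1986_thm_I_7_3)
    (hWald : waldspurger_exists_heegnerField_twist_ne_zero) (hDel : Delbourgo2002.mainTheorem)
    (hmod : hasEntireLFunction_rat) (hmodD : nonempty_modularParametrizationData)
    (hmodN : exists_isNewformOf) (hGZK : rank_eq_analyticRank_of_analyticRank_le_one)
    (hc : N10.CellGordTwo W p) (hp4 : p % 4 = 1) (hcm : ¬ W.HasCM) (hr : W.analyticRank = 1)
    (hunit : BranchUnitCoeffAt W p 1) : MissingLowerBoundAt W p := by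
  obtain ⟨hp2, haddv, hG, he⟩ := hc
  have hp5 : 5 ≤ p := by have := hp.out.two_le; omega
  have hev : Even (p / 2) := ⟨p / 4, by omega⟩
  -- the twist model, its newform and period ratio
  obtain ⟨V, iV, iVm, C, hV, hC⟩ := TypeGOrd.exists_goodOrd_pStar_twist_model W p hp2 hG haddv he
  haveI : NeZero (V.conductorNorm ℤ) := ⟨(V.conductorNorm_pos_holds).ne'⟩
  obtain ⟨Dm⟩ := hmodD V
  obtain ⟨ϖ, -, hϖ, -⟩ := Dm.exists_rat_mul_realPeriodRat_eq_plusPeriod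
  -- gen 0 §1: the datum and the identity, from published facts
  obtain ⟨Dh, hBι, -, u, q, hlead, hpgz⟩ := exists_datum_identity_of_facts hCyc hArt h73 hWald hmod hmodD
    hmodN hGZK haddv hG hp4 hcm hr V C hV hC Dm.isNewformOf ϖ hϖ
  -- the certificate at this triple: `‖ϖ·[T¹]B‖ = 1`
  have ha : ‖(ϖ : ℚ_[p]) *
      PowerSeries.coeff 1 (padicLFunctionBranch Dm.f ((unitRoot V p : ℤ_[p]) : ℚ_[p]) (p / 2))‖ = 1 := by
    have h1 := hunit V C hC ⟨hV.1, hV.2⟩ Dm.f Dm.isNewformOf ϖ (by rw [if_pos hev]; exact hϖ)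
    rwa [if_pos hev, PowerSeries.coeff_C_mul] at h1
  -- the two unit factors at the place over `p` (Mazur 1972 via the twist transport)
  set v₀ : HeightOneSpectrum (𝓞 ℚ) := (Rat.HeightOneSpectrum.primesEquiv (R := 𝓞 ℚ)).symm ⟨p, hp.out⟩
    with hv₀_def
  have hv₀ : (p : 𝓞 ℚ) ∈ v₀.asIdeal := natCast_mem_asIdeal_of_primesEquiv_eq (primesEquiv_symm_apply_coe p)
  have hcp0 : W.tamagawaNumberAt v₀ ≠ 0 := (tamagawaNumberAt_ne_zero_and_le_four_of_addv W p haddv).1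
  have hι : ∀ κ : ZpExtension ℚ p, κ.IsCyclotomic →
      localUniversalNormIndex (W := W) (v₀.adicCompletion ℚ) κ ⊤ ≠ 0 →
      ¬ p ∣ localUniversalNormIndex (W := W) (v₀.adicCompletion ℚ) κ ⊤ :=
    fun κ hκ h0 ↦ UniversalNormTwist.not_dvd_localUniversalNormIndex_of_goodOrd_twist V W κ v₀ hMaz hp2
      hV.1 (by exact_mod_cast hV.2) hκ hv₀ hC h0
  exact missingLowerBoundAt_rankOne_of_identity_of_norm_eq_one hGZK hr hp2 hBι
    (fun κ' γ hκ' hγ D ↦ hDel.isTorsion hp5 hcm haddv hG hκ' hγ D) v₀ hv₀ hcp0 hι hlead hpgz ha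

/-! ### §3 Cell (G-ord, `e = 2`), `p ≡ 3 (mod 4)`, `p ≥ 7`: the same on the MINUS branch -/

/-- **Cell (G-ord, `e = 2`), `p ≡ 3 (mod 4)`, `p ≥ 7` (`5 ≤ p`), `E` non-CM, `r_an(E) = 1`, ANY residual image,
ANOMALOUS OR NOT: the LOWER half `ord_p #Ш(E)_an ≤ ord_p #Ш(E)` from PUBLISHED named facts + the ONE per-pair
certificate `BranchUnitCoeffAt W p 1`** (minus symbols: `‖ϖ⁻·[T¹]L_p⁻(f_V, α_V, ω^{(p−1)/2})‖_p = 1`,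
`ϖ⁻·|Ω⁻_V| = Ω⁻_f`). Odd twin of §2: gen 0's `exists_datum_identity_odd_of_facts` (file `…OddBranch`), then the
core; the Λ-adic input `ChiBranchLowerDivisibilityOddAt` of
`cellGordTwo_missingLowerBoundAt_rankOne_odd_of_facts_of_chiBranchLowerOdd_of_branchCoeffOneNeZero` is idle here.
[cite: Delbourgo2002, Theorem (A), (B) (p. 40), p. 67 (iv), p. 69] [cite: Mazur1972Towers, Cor. 5.15]
[cite: Disegni2017, Theorem A/B (arXiv v3 PDF 7–9)] [cite: MazurTateTeitelbaum1986Invent, §I.13]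
[cite: Miller2011LMS, Def. 1.1] -/
theorem cellGordTwo_missingLowerBoundAt_rankOne_odd_of_facts_of_unitCoeffOne
    (hMaz : Mazur1972.cor515_universalNormIndex) (hCyc : delbourgoDatum_cycLineGrossZagier)
    (hArt : rankinSelbergEulerProductHecke_baseChangeDirichlet_eq) (h73 : GrossZagier1986_thm_I_7_3)
    (hWald : waldspurger_exists_heegnerField_twist_ne_zero) (hDel : Delbourgo2002.mainTheorem)
    (hmod : hasEntireLFunction_rat) (hmodD : nonempty_modularParametrizationData)
    (hmodN : exists_isNewformOf) (hGZK : rank_eq_analyticRank_of_analyticRank_le_one)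
    (hc : N10.CellGordTwo W p) (hp4 : p % 4 = 3) (hp5 : 5 ≤ p) (hcm : ¬ W.HasCM)
    (hr : W.analyticRank = 1) (hunit : BranchUnitCoeffAt W p 1) : MissingLowerBoundAt W p := by
  obtain ⟨hp2, haddv, hG, he⟩ := hc
  have hodd : ¬ Even (p / 2) := fun ⟨k, hk⟩ ↦ by omega
  -- the twist model, its newform and minus period ratio
  obtain ⟨V, iV, iVm, C, hV, hC⟩ := TypeGOrd.exists_goodOrd_pStar_twist_model W p hp2 hG haddv he
  haveI : NeZero (V.conductorNorm ℤ) := ⟨(V.conductorNorm_pos_holds).ne'⟩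
  obtain ⟨Dm⟩ := hmodD V
  obtain ⟨ϖ, -, hϖ⟩ := exists_rat_mul_imaginaryPeriodRat_eq_minusPeriod Dm
  -- gen 0 §1 (odd): the datum and the identity, from published facts
  obtain ⟨Dh, hBι, -, u, q, hlead, hpgz⟩ := exists_datum_identity_odd_of_facts hCyc hArt h73 hWald hmod
    hmodD hmodN hGZK haddv hG hp4 hp5 hcm hr V C hV hC Dm.isNewformOf ϖ hϖ
  -- the certificate at this triple: `‖ϖ·[T¹]B⁻‖ = 1`
  have ha : ‖(ϖ : ℚ_[p]) *
      PowerSeries.coeff 1 (padicLFunctionMinusBranch Dm.f ((unitRoot V p : ℤ_[p]) : ℚ_[p]) (p / 2))‖ = 1 := by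
    have h1 := hunit V C hC ⟨hV.1, hV.2⟩ Dm.f Dm.isNewformOf ϖ (by rw [if_neg hodd]; exact hϖ)
    rwa [if_neg hodd, PowerSeries.coeff_C_mul] at h1
  -- the two unit factors at the place over `p`
  set v₀ : HeightOneSpectrum (𝓞 ℚ) := (Rat.HeightOneSpectrum.primesEquiv (R := 𝓞 ℚ)).symm ⟨p, hp.out⟩
    with hv₀_def
  have hv₀ : (p : 𝓞 ℚ) ∈ v₀.asIdeal := natCast_mem_asIdeal_of_primesEquiv_eq (primesEquiv_symm_apply_coe p)
  have hcp0 : W.tamagawaNumberAt v₀ ≠ 0 := (tamagawaNumberAt_ne_zero_and_le_four_of_addv W p haddv).1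
  have hι : ∀ κ : ZpExtension ℚ p, κ.IsCyclotomic →
      localUniversalNormIndex (W := W) (v₀.adicCompletion ℚ) κ ⊤ ≠ 0 →
      ¬ p ∣ localUniversalNormIndex (W := W) (v₀.adicCompletion ℚ) κ ⊤ :=
    fun κ hκ h0 ↦ UniversalNormTwist.not_dvd_localUniversalNormIndex_of_goodOrd_twist V W κ v₀ hMaz hp2
      hV.1 (by exact_mod_cast hV.2) hκ hv₀ hC h0
  exact missingLowerBoundAt_rankOne_of_identity_of_norm_eq_one hGZK hr hp2 hBι
    (fun κ' γ hκ' hγ D ↦ hDel.isTorsion hp5 hcm haddv hG hκ' hγ D) v₀ hv₀ hcp0 hι hlead hpgz ha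

/-! ### §4 Cell (G-ord, `e = 2`) at `p = 3`, anomalous or not: the same with the `p = 3` (B♮) fact -/

/-- **Cell (G-ord, `e = 2`) at `p = 3`, `E` non-CM, ANOMALOUS OR NOT, `r_an(E) = 1`, ANY residual image: the
LOWER half `ord_3 #Ш(E)_an ≤ ord_3 #Ш(E)` from PUBLISHED named facts (`hMaz`, `hCyc3`, `hArt`, `h73`, `hWald`,
`hDel3`, modularity, GZK) + the ONE per-pair certificate `BranchUnitCoeffAt W 3 1`.** The `p = 3` twin of §3:
gen 0's `exists_datum_identity_three_intrinsic_of_facts` (file `…CruxShape` §0), Delbourgo (A) at `3`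
(`TypeGOrd.isTorsion_three_of_delbourgo2002`), then the core; the Λ-adic input of
`cellGordTwo_missingLowerBoundAt_rankOne_three_intrinsic_of_facts_of_chiBranchLowerOdd_of_branchCoeffOneNeZero`
is idle here. [cite: Delbourgo2002, Theorem (A), (B) (p. 40), p. 67 (iv), p. 69; Hypothesis (p. 39) second bullet]
[cite: Mazur1972Towers, Cor. 5.15 with Remark (p. 229)] [cite: Disegni2017, Theorem A/B (arXiv v3 PDF 7–9)]
[cite: MazurTateTeitelbaum1986Invent, §I.13] [cite: Miller2011LMS, Def. 1.1] -/
theorem cellGordTwo_missingLowerBoundAt_rankOne_three_of_facts_of_unitCoeffOne [hp3 : Fact (Nat.Prime 3)]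
    {W : WeierstrassCurve ℚ} [W.IsElliptic] [W.IsGloballyMinimal]
    (hMaz : Mazur1972.cor515_universalNormIndex) (hCyc3 : delbourgoDatum_cycLineGrossZagier_intrinsicThree)
    (hArt : rankinSelbergEulerProductHecke_baseChangeDirichlet_eq) (h73 : GrossZagier1986_thm_I_7_3)
    (hWald : waldspurger_exists_heegnerField_twist_ne_zero) (hDel3 : Delbourgo2002.mainTheorem_three)
    (hmod : hasEntireLFunction_rat) (hmodD : nonempty_modularParametrizationData)
    (hmodN : exists_isNewformOf) (hGZK : rank_eq_analyticRank_of_analyticRank_le_one)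
    (hc : N10.CellGordTwo W 3) (hcm : ¬ W.HasCM) (hr : W.analyticRank = 1)
    (hunit : BranchUnitCoeffAt W 3 1) : MissingLowerBoundAt W 3 := by
  obtain ⟨hp2, haddv, hG, he⟩ := hc
  have hodd : ¬ Even ((3 : ℕ) / 2) := by decide
  obtain ⟨V, iV, iVm, C, hV, hC⟩ := TypeGOrd.exists_goodOrd_pStar_twist_model W 3 hp2 hG haddv he
  haveI : NeZero (V.conductorNorm ℤ) := ⟨(V.conductorNorm_pos_holds).ne'⟩
  obtain ⟨Dm⟩ := hmodD V
  obtain ⟨ϖ, -, hϖ⟩ := exists_rat_mul_imaginaryPeriodRat_eq_minusPeriod Dm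
  obtain ⟨Dh, hBι, -, u, q, hlead, hpgz⟩ := exists_datum_identity_three_intrinsic_of_facts hCyc3 hArt h73
    hWald hmod hmodD hmodN hGZK haddv hG hcm hr V C hV hC Dm.isNewformOf ϖ hϖ
  have ha : ‖(ϖ : ℚ_[3]) *
      PowerSeries.coeff 1
        (padicLFunctionMinusBranch Dm.f ((unitRoot V 3 : ℤ_[3]) : ℚ_[3]) ((3 : ℕ) / 2))‖ = 1 := by
    have h1 := hunit V C hC ⟨hV.1, hV.2⟩ Dm.f Dm.isNewformOf ϖ (by rw [if_neg hodd]; exact hϖ)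
    rwa [if_neg hodd, PowerSeries.coeff_C_mul] at h1
  -- the two unit factors at the place over `3`
  set v₀ : HeightOneSpectrum (𝓞 ℚ) := (Rat.HeightOneSpectrum.primesEquiv (R := 𝓞 ℚ)).symm ⟨3, hp3.out⟩
    with hv₀_def
  have hv₀ : ((3 : ℕ) : 𝓞 ℚ) ∈ v₀.asIdeal :=
    natCast_mem_asIdeal_of_primesEquiv_eq (primesEquiv_symm_apply_coe 3)
  have hcp0 : W.tamagawaNumberAt v₀ ≠ 0 := (tamagawaNumberAt_ne_zero_and_le_four_of_addv W 3 haddv).1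
  have hι : ∀ κ : ZpExtension ℚ 3, κ.IsCyclotomic →
      localUniversalNormIndex (W := W) (v₀.adicCompletion ℚ) κ ⊤ ≠ 0 →
      ¬ 3 ∣ localUniversalNormIndex (W := W) (v₀.adicCompletion ℚ) κ ⊤ :=
    fun κ hκ h0 ↦ UniversalNormTwist.not_dvd_localUniversalNormIndex_of_goodOrd_twist V W κ v₀ hMaz hp2
      hV.1 (by exact_mod_cast hV.2) hκ hv₀ hC h0
  exact missingLowerBoundAt_rankOne_of_identity_of_norm_eq_one hGZK hr hp2 hBι
    (fun κ' γ hκ' hγ D ↦ TypeGOrd.isTorsion_three_of_delbourgo2002 hDel3 hG haddv hcm hκ' hγ D) v₀ hv₀ hcp0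
    hι hlead hpgz ha

/-! ### §5 The UNIT SLICE of crux `GordTwoRankOne`, all odd `p`; the crux BY NAME reduced to content rows -/

/-- **The unit slice of crux `GordTwoRankOne`, NON-CM rows, every odd `p` (`p = 3` anomalous or not).** For
every globally minimal `E/ℚ` without CM, of analytic rank `1`, every (G-ord, `e = 2`) additive odd prime `p`, IF
the Néron-normalised first branch coefficient is a `p`-adic unit at every good-ordinary twist model
(`BranchUnitCoeffAt W p 1`, certified per pair) THEN `ord_p #Ш(E)_an ≤ ord_p #Ш(E)` — from the PUBLISHED binders
alone (`hMaz`, `hCyc`, `hCyc3`, `hArt`, `h73`, `hWald`, `hDel`, `hDel3`, `hmod`, `hmodD`, `hmodN`, `hGZK`): NO Λ-adic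
input, NO Kato / Wuthrich reading, NO image hypothesis. Case split `p = 3` / `p ≡ 1 (mod 4)` / `p ≡ 3 (mod 4)`
on §4 / §2 / §3. [cite: Delbourgo2002, Theorem (A), (B) (p. 40), p. 67 (iv), p. 69] [cite: Mazur1972Towers, Cor. 5.15]
[cite: Disegni2017, Theorem A/B (arXiv v3 PDF 7–9)] [cite: Miller2011LMS, Def. 1.1] -/
theorem gordTwoRankOne_unitSlice_of_facts_cmFree
    (hMaz : Mazur1972.cor515_universalNormIndex) (hCyc : delbourgoDatum_cycLineGrossZagier)
    (hCyc3 : delbourgoDatum_cycLineGrossZagier_intrinsicThree)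
    (hArt : rankinSelbergEulerProductHecke_baseChangeDirichlet_eq) (h73 : GrossZagier1986_thm_I_7_3)
    (hWald : waldspurger_exists_heegnerField_twist_ne_zero) (hDel : Delbourgo2002.mainTheorem)
    (hDel3 : Delbourgo2002.mainTheorem_three)
    (hmod : hasEntireLFunction_rat) (hmodD : nonempty_modularParametrizationData)
    (hmodN : exists_isNewformOf) (hGZK : rank_eq_analyticRank_of_analyticRank_le_one) :
    ∀ (W : WeierstrassCurve ℚ) [W.IsElliptic] [W.IsGloballyMinimal] (p : ℕ) [Fact p.Prime],
      W.analyticRank = 1 → N10.CellGordTwo W p → ¬ W.HasCM → BranchUnitCoeffAt W p 1 →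
      MissingLowerBoundAt W p := by
  intro W _ _ p hpF hr hc hcm hunit
  by_cases hp3 : p = 3
  · subst hp3
    exact cellGordTwo_missingLowerBoundAt_rankOne_three_of_facts_of_unitCoeffOne hMaz hCyc3 hArt h73 hWald
      hDel3 hmod hmodD hmodN hGZK hc hcm hr hunit
  · have hp5 : 5 ≤ p := hpF.out.five_le_of_ne_two_of_ne_three hc.1 hp3
    have hodd : p % 4 = 1 ∨ p % 4 = 3 := by
      obtain ⟨k, hk⟩ := hpF.out.odd_of_ne_two hc.1
      omega
    rcases hodd with h1 | h3
    · exact cellGordTwo_missingLowerBoundAt_rankOne_of_facts_of_unitCoeffOne hMaz hCyc hArt h73 hWald hDel hmod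
        hmodD hmodN hGZK hc h1 hcm hr hunit
    · exact cellGordTwo_missingLowerBoundAt_rankOne_odd_of_facts_of_unitCoeffOne hMaz hCyc hArt h73 hWald hDel
        hmod hmodD hmodN hGZK hc h3 hp5 hcm hr hunit

/-- **THE UNIT SLICE OF CRUX `GordTwoRankOne` (item 19358), CM ROWS INCLUDED.** For every globally minimal
`E/ℚ` of analytic rank `1` and every (G-ord, `e = 2`) additive odd prime `p`: IF `‖A′(E,p)‖_p = 1`
(`BranchUnitCoeffAt W p 1`, ONE certified number per pair) THEN `ord_p #Ш(E)_an ≤ ord_p #Ш(E)`. Published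
binders only: the twelve of `gordTwoRankOne_unitSlice_of_facts_cmFree` + Li–Liu–Tian 2024 Thm. 1.1 (i) (`hLLT`,
the CM rows — which need no certificate at all, `gordTwoRankOne_cm_of_liLiuTian`). This is the crux's statement
verbatim with ONE extra per-pair hypothesis; what is left of the crux is the complement (next theorem).
[cite: LiLiuTian2024, Thm. 1.1 (i)] [cite: Delbourgo2002, Theorem (A), (B) (p. 40)] [cite: Disegni2017, Theorem A/B]
[cite: Mazur1972Towers, Cor. 5.15] [cite: Miller2011LMS, Def. 1.1] -/
theorem gordTwoRankOne_unitSlice_of_facts_of_liLiuTian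
    (hMaz : Mazur1972.cor515_universalNormIndex) (hCyc : delbourgoDatum_cycLineGrossZagier)
    (hCyc3 : delbourgoDatum_cycLineGrossZagier_intrinsicThree)
    (hArt : rankinSelbergEulerProductHecke_baseChangeDirichlet_eq) (h73 : GrossZagier1986_thm_I_7_3)
    (hWald : waldspurger_exists_heegnerField_twist_ne_zero) (hDel : Delbourgo2002.mainTheorem)
    (hDel3 : Delbourgo2002.mainTheorem_three)
    (hmod : hasEntireLFunction_rat) (hmodD : nonempty_modularParametrizationData)
    (hmodN : exists_isNewformOf) (hGZK : rank_eq_analyticRank_of_analyticRank_le_one)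
    (hLLT : LiLiuTian2024.thm11_bsdp_of_cm_rank_one) :
    ∀ (W : WeierstrassCurve ℚ) [W.IsElliptic] [W.IsGloballyMinimal] (p : ℕ) [Fact p.Prime],
      W.analyticRank = 1 → N10.CellGordTwo W p → BranchUnitCoeffAt W p 1 → MissingLowerBoundAt W p := by
  intro W _ _ p _ hr hc hunit
  by_cases hcm : W.HasCM
  · exact gordTwoRankOne_cm_of_liLiuTian hLLT W p hr hc hcm
  · exact gordTwoRankOne_unitSlice_of_facts_cmFree hMaz hCyc hCyc3 hArt h73 hWald hDel hDel3 hmod hmodD hmodN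
      hGZK W p hr hc hcm hunit

end Summit.BirchSwinnertonDyer.BirchSwinnertonDyer.Theorems.AdditiveBranchIMCGordTwoRankOne

end
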